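import Literature.NumberTheory.EllipticCurves.EisensteinNewformLevelRaisingOrdinaryUnitRootProofs
import Literature.NumberTheory.EllipticCurves.PAdicLFunctionInterpolationHoldsProofs
import Literature.NumberTheory.EllipticCurves.LFunctionPrimeCoeff
import HarnessLib

/-!
# The unit-root dichotomy at a good ordinary prime, read through `ι : ℚ̄_p ≃ ℂ` (proofs only)

A theorems-only file (no definition, no named fact; D-0026; 0 debt) closing the RESIDUAL TREE TASK
recorded by the cross-ladder literature-typing layer (cell `bsd-littype`, D-0088(4);
`pub/bsd-littype/OPEN-QUESTIONS-01.md` §G Q20, seat 01 g4: "discharge the dictionary hypothesis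
(`GoodOrd W p` ⇒ exactly one unit root in `ℂ_p`: integrality `‖ι⁻¹α‖ ≤ 1` + `‖ι⁻¹a_p‖ = 1` +
ultrametric) — not in the tree as a lemma") behind the two-variable Greenberg-side `L`-carriers
of Yan–Zhu 2026 / Castella–Grossi–Skinner 2025 / Burungale–Skinner–Tian–Wan 2024: the VALUE frames
`IsGreenbergLFunctionAnyRoot₂` (any complex root `α` of `X² − a_p X + p`,
`BurungaleSkinnerTianWan2024/GreenbergMainStatementOPEN.lean`) and the superseded
`YanZhu2026.….IsGreenbergLFunction₂` (the root with `‖ι⁻¹α‖ = 1`), and the PRODUCT frame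
`CastellaGrossiSkinner2025.IsHidaRankinLFunctionII` (the root
`ι(unitRoot W p)`, `unitRoot W p ∈ ℤ_p` the Hensel root of `PAdicLFunction.lean`). Seat
`bsd-littype-02` (gen 4), whose carrier `IsHidaRankinLFunctionII` is one of the three.

PRINTED CONTEXT. Castella–Grossi–Skinner, Math. Ann. 393 (2025), §4 (final TeX l.1659–1663):
"We assume that `f` is ordinary at `p`, i.e., `a_p ∈ ℤ_p^×`, so there is a `G_p`-stable filtration
… with the `G_p`-action on `T_f^-` given by the unramified character sending an arithmetic
Frobenius to the `p`-adic unit root of `x² − a_p x + p`"; Yan–Zhu, J. Algebra (2026), Thm. 3.9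
(arXiv:2412.20078v4 l.846): the type-II Euler factor `𝓔(ξ, f, 1)` in the unit root `α`;
Mazur–Tate–Teitelbaum, Invent. Math. 84 (1986), §I.11 ("allowable root"). The content is
folklore `p`-adic algebra: for `a ∈ ℤ` with `p ∤ a` and a complex root `β` of `X² − aX + p`,
transported to `ℚ̄_p = PadicAlgCl p` along `ι⁻¹`, EXACTLY ONE of `β` and its companion
`a − β = p/β` is a `p`-adic unit, the other has absolute value `< 1`
(`norm_symm_root_dichotomy`, from the tree's abstract `quadratic_norm_root_lt_one_or` with
`‖ι⁻¹ a‖ = 1`, `‖p‖ < 1`); and the unit one IS the tree's Hensel root: `ι⁻¹ β = unitRoot W p` in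
`ℚ̄_p` (`symm_eq_algebraMap_unitRoot_of_norm_eq_one`, from `unitRoot_coe_spec` and the tree's
`quadratic_unitRoot_unique`). For the newform `f` of `E` (`IsNewformOf W f`) the Hecke polynomial
of the value frames, `X² − cuspCoeff f p · X + p`, is this polynomial with `a = a_p(E)`
(`IsNewformOf.cuspCoeff_prime_eq_frobeniusTrace`, via `LFunction_apply_prime_eq_frobeniusTrace`),
so every root clause `α ^ 2 - cuspCoeff f p * α + p = 0` of `IsGreenbergLFunctionAnyRoot₂` at a good
ORDINARY `p` splits into "`α` is THE unit root `ι(unitRoot W p)`" or "`p/α` is"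
(`eq_unitRoot_or_div_eq_unitRoot_of_isNewformOf`). Nothing here is asserted beyond theorems.

References: [CastellaGrossiSkinner2025] §4 (l.1659–1663), Thm. 2.4.1; [YanZhu2024MainConjNonCM]
Thm. 3.9; [MazurTateTeitelbaum1986Invent] §I.11; tree `PAdicLFunction.lean` (`unitRoot`,
`IsOrdinaryAt`), `EisensteinNewformLevelRaisingOrdinaryUnitRootProofs.lean`
(`quadratic_norm_root_lt_one_or`, `quadratic_unitRoot_unique`), `LFunctionPrimeCoeff.lean`.
-/

noncomputable section

open scoped ModularForm

open CongruenceSubgroup WeierstrassCurve Literature.NumberTheory.EllipticCurves.ModularForms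

namespace Literature.NumberTheory.EllipticCurves

variable {p : ℕ} [Fact p.Prime]

/-! ### `p`-adic sizes of the coefficients `a ∈ ℤ ∖ pℤ` and `p` in `ℚ̄_p` -/

/-- `‖p‖ < 1` in `ℚ̄_p` (`= p⁻¹`) (private copy of the Automorphic area's
`PadicAlgCl.norm_natCast_p_lt_one`, not imported here). [folklore] -/
private theorem PadicAlgCl.norm_natCast_self_lt_one : ‖(p : PadicAlgCl p)‖ < 1 := by
  have hp : p.Prime := Fact.out
  rw [← map_natCast (algebraMap ℚ_[p] (PadicAlgCl p)) p, norm_algebraMap', Padic.norm_p]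
  exact inv_lt_one_of_one_lt₀ (by exact_mod_cast hp.one_lt)

/-- An integer prime to `p` is a `p`-adic unit in `ℚ̄_p`: `‖a‖ = 1`. [folklore] -/
private theorem PadicAlgCl.norm_intCast_eq_one_of_not_dvd {a : ℤ} (ha : ¬ (p : ℤ) ∣ a) :
    ‖(a : PadicAlgCl p)‖ = 1 := by
  rw [← map_intCast (algebraMap ℚ_[p] (PadicAlgCl p)) a, norm_algebraMap']
  exact le_antisymm (Padic.norm_int_le_one a)
    (not_lt.mp fun h ↦ ha (Padic.norm_intCast_lt_one_iff.mp h))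

/-! ### The dichotomy for `X² − aX + p`, `p ∤ a`, read through `ι⁻¹` -/

section Dichotomy

variable (ι : PadicAlgCl p ≃+* ℂ) {a : ℤ} {β : ℂ}

/-- Transport of the root relation along `ι⁻¹ : ℂ → ℚ̄_p`. [folklore] -/
private theorem quadraticP_symm_root (hβ : β ^ 2 - (a : ℂ) * β + p = 0) :
    ι.symm β ^ 2 - (a : PadicAlgCl p) * ι.symm β + p = 0 := by
  have h := congr_arg ι.symm hβ
  rwa [map_zero, map_add, map_sub, map_pow, map_mul, map_intCast, map_natCast] at h

/-- A root `β` of `X² − aX + p` (`p` prime) is non-zero. [folklore] -/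
private theorem quadraticP_root_ne_zero (hβ : β ^ 2 - (a : ℂ) * β + p = 0) : β ≠ 0 := by
  rintro rfl
  have hp : p.Prime := Fact.out
  have : (p : ℂ) = 0 := by simpa using hβ
  exact hp.ne_zero (by exact_mod_cast this)

/-- The companion root: `a − β = p / β` (Mazur–Tate–Teitelbaum's two roots `α`, `p/α` of
`X² − a_p X + p`). [cite: MazurTateTeitelbaum1986Invent, §I.11 (the roots α, β = p/α)] -/
theorem quadraticP_intCast_sub_eq_div (hβ : β ^ 2 - (a : ℂ) * β + p = 0) :
    (a : ℂ) - β = p / β := by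
  rw [eq_div_iff (quadraticP_root_ne_zero hβ)]
  linear_combination (-1 : ℂ) * hβ

omit [Fact p.Prime] in
/-- The companion `a − β` is again a root of `X² − aX + p`. [folklore] -/
private theorem quadraticP_companion_root (hβ : β ^ 2 - (a : ℂ) * β + p = 0) :
    ((a : ℂ) - β) ^ 2 - (a : ℂ) * ((a : ℂ) - β) + p = 0 := by
  linear_combination hβ

/-- **The unit-root dichotomy.** For `a ∈ ℤ` with `p ∤ a` and a complex root `β` of
`X² − aX + p`: read in `ℚ̄_p` through `ι⁻¹`, either `‖ι⁻¹β‖ < 1` and the companion `a − β` is a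
`p`-adic unit, or `β` is a `p`-adic unit and `‖ι⁻¹(a − β)‖ < 1` (indeed `= ‖p‖ = p⁻¹`).
(`‖ι⁻¹a‖ = 1`, `‖p‖ < 1`, ultrametric inequality: the tree's `quadratic_norm_root_lt_one_or`.)
[cite: MazurTateTeitelbaum1986Invent, §I.11 (allowable root)] -/
theorem norm_symm_root_dichotomy (ha : ¬ (p : ℤ) ∣ a) (hβ : β ^ 2 - (a : ℂ) * β + p = 0) :
    (‖ι.symm β‖ < 1 ∧ ‖ι.symm ((a : ℂ) - β)‖ = 1) ∨
      (‖ι.symm β‖ = 1 ∧ ‖ι.symm ((a : ℂ) - β)‖ < 1) := by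
  have hsub : ι.symm ((a : ℂ) - β) = (a : PadicAlgCl p) - ι.symm β := by
    rw [map_sub, map_intCast]
  rw [hsub]
  rcases quadratic_norm_root_lt_one_or (PadicAlgCl.norm_intCast_eq_one_of_not_dvd ha)
      PadicAlgCl.norm_natCast_self_lt_one (quadraticP_symm_root ι hβ) with h | ⟨h1, h2⟩
  · exact Or.inl h
  · exact Or.inr ⟨h1, h2.trans_lt PadicAlgCl.norm_natCast_self_lt_one⟩

/-- **Exactly one of `β`, `a − β` is a `p`-adic unit.** [cite: MazurTateTeitelbaum1986Invent, §I.11 (allowable root)] -/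
theorem norm_symm_eq_one_xor (ha : ¬ (p : ℤ) ∣ a) (hβ : β ^ 2 - (a : ℂ) * β + p = 0) :
    Xor (‖ι.symm β‖ = 1) (‖ι.symm ((a : ℂ) - β)‖ = 1) := by
  rcases norm_symm_root_dichotomy ι ha hβ with ⟨h1, h2⟩ | ⟨h1, h2⟩
  · exact Or.inr ⟨h2, h1.ne⟩
  · exact Or.inl ⟨h1, h2.ne⟩

/-- **"One of `α`, `p/α` is a `p`-adic unit"** — the form in which the dichotomy was asked for
(`pub/bsd-littype/OPEN-QUESTIONS-01.md` Q20). [cite: MazurTateTeitelbaum1986Invent, §I.11 (allowable root)] -/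
theorem norm_symm_eq_one_or_norm_symm_div_eq_one (ha : ¬ (p : ℤ) ∣ a)
    (hβ : β ^ 2 - (a : ℂ) * β + p = 0) :
    ‖ι.symm β‖ = 1 ∨ ‖ι.symm ((p : ℂ) / β)‖ = 1 := by
  rw [← quadraticP_intCast_sub_eq_div hβ]
  rcases norm_symm_root_dichotomy ι ha hβ with ⟨-, h⟩ | ⟨h, -⟩
  · exact Or.inr h
  · exact Or.inl h

/-- Every complex root read in `ℚ̄_p` is `p`-integral: `‖ι⁻¹β‖ ≤ 1`.
[cite: MazurTateTeitelbaum1986Invent, §I.11 (allowable root)] -/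
theorem norm_symm_root_le_one (ha : ¬ (p : ℤ) ∣ a) (hβ : β ^ 2 - (a : ℂ) * β + p = 0) :
    ‖ι.symm β‖ ≤ 1 := by
  rcases norm_symm_root_dichotomy ι ha hβ with ⟨h, -⟩ | ⟨h, -⟩
  · exact h.le
  · exact h.le

end Dichotomy

/-! ### The unit root among `{β, p/β}` is the tree's Hensel root `unitRoot W p` -/

section UnitRoot

variable (ι : PadicAlgCl p ≃+* ℂ) (W : WeierstrassCurve ℚ) [W.IsGloballyMinimal]

/-- The tree's `unitRoot W p ∈ ℤ_p`, read in `ℚ̄_p`: at a good ordinary prime it is a root of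
`X² − a_p X + p` of absolute value `1` (`unitRoot_coe_spec`, Hensel). [cite: MazurTateTeitelbaum1986Invent, §I.11] -/
theorem algebraMap_unitRoot_spec (hord : IsOrdinaryAt W p) :
    (algebraMap ℚ_[p] (PadicAlgCl p) (unitRoot W p : ℚ_[p])) ^ 2 -
          ((W.frobeniusTrace p : ℤ) : PadicAlgCl p) *
            algebraMap ℚ_[p] (PadicAlgCl p) (unitRoot W p : ℚ_[p]) + p = 0 ∧
      ‖algebraMap ℚ_[p] (PadicAlgCl p) (unitRoot W p : ℚ_[p])‖ = 1 := by
  obtain ⟨hroot, hnorm, -⟩ := unitRoot_coe_spec (W := W) hord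
  refine ⟨?_, by rw [norm_algebraMap', hnorm]⟩
  have h := congr_arg (algebraMap ℚ_[p] (PadicAlgCl p)) hroot
  rwa [map_zero, map_add, map_sub, map_pow, map_mul, map_intCast, map_natCast] at h

variable {W} {β : ℂ}

/-- **The `p`-adic unit root coming from `ℂ` is the Hensel root**: if `β ∈ ℂ` is a root of
`X² − a_p(E) X + p` with `‖ι⁻¹β‖ = 1` at a good ordinary `p`, then `ι⁻¹β = unitRoot W p` in `ℚ̄_p`
(uniqueness of the unit root, `quadratic_unitRoot_unique`). [cite: MazurTateTeitelbaum1986Invent, §I.11 (allowable root)] -/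
theorem symm_eq_algebraMap_unitRoot_of_norm_eq_one (hord : IsOrdinaryAt W p)
    (hβ : β ^ 2 - ((W.frobeniusTrace p : ℤ) : ℂ) * β + p = 0) (h1 : ‖ι.symm β‖ = 1) :
    ι.symm β = algebraMap ℚ_[p] (PadicAlgCl p) (unitRoot W p : ℚ_[p]) := by
  obtain ⟨hu, hu1⟩ := algebraMap_unitRoot_spec W hord
  exact quadratic_unitRoot_unique PadicAlgCl.norm_natCast_self_lt_one h1 (quadraticP_symm_root ι hβ)
    hu1 hu

/-- Same, read back in `ℂ`: the unit root is `ι(unitRoot W p)` — the `α_p` of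
`CastellaGrossiSkinner2025.hidaIIInterpolationValue`. [cite: CastellaGrossiSkinner2025, Thm. 2.4.1 (α_p the p-adic unit root, §4 l.1659–1663)] -/
theorem eq_unitRoot_of_norm_eq_one (hord : IsOrdinaryAt W p)
    (hβ : β ^ 2 - ((W.frobeniusTrace p : ℤ) : ℂ) * β + p = 0) (h1 : ‖ι.symm β‖ = 1) :
    β = ι (algebraMap ℚ_[p] (PadicAlgCl p) (unitRoot W p : ℚ_[p])) := by
  rw [← symm_eq_algebraMap_unitRoot_of_norm_eq_one ι hord hβ h1, RingEquiv.apply_symm_apply]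

/-- **At a good ordinary prime every complex root `β` of `X² − a_p X + p` is either THE unit root
`ι(unitRoot W p)` or its companion `p/β` is.** [cite: MazurTateTeitelbaum1986Invent, §I.11 (allowable root)] -/
theorem eq_unitRoot_or_div_eq_unitRoot (hord : IsOrdinaryAt W p)
    (hβ : β ^ 2 - ((W.frobeniusTrace p : ℤ) : ℂ) * β + p = 0) :
    β = ι (algebraMap ℚ_[p] (PadicAlgCl p) (unitRoot W p : ℚ_[p])) ∨
      (p : ℂ) / β = ι (algebraMap ℚ_[p] (PadicAlgCl p) (unitRoot W p : ℚ_[p])) := by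
  rcases norm_symm_root_dichotomy ι hord.2 hβ with ⟨-, h⟩ | ⟨h, -⟩
  · refine Or.inr ?_
    rw [← quadraticP_intCast_sub_eq_div hβ]
    exact eq_unitRoot_of_norm_eq_one ι hord (quadraticP_companion_root hβ) h
  · exact Or.inl (eq_unitRoot_of_norm_eq_one ι hord hβ h)

/-- **The unit root exists in `ℂ`**: `β₀ := ι(unitRoot W p)` is a complex root of `X² − a_p X + p`
with `‖ι⁻¹β₀‖ = 1`, and its companion `a_p − β₀` has `‖ι⁻¹(a_p − β₀)‖ < 1`.
[cite: MazurTateTeitelbaum1986Invent, §I.11 (allowable root)] -/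
theorem unitRoot_complex_spec (hord : IsOrdinaryAt W p) :
    (ι (algebraMap ℚ_[p] (PadicAlgCl p) (unitRoot W p : ℚ_[p]))) ^ 2 -
          ((W.frobeniusTrace p : ℤ) : ℂ) * ι (algebraMap ℚ_[p] (PadicAlgCl p) (unitRoot W p : ℚ_[p]))
          + p = 0 ∧
      ‖ι.symm (ι (algebraMap ℚ_[p] (PadicAlgCl p) (unitRoot W p : ℚ_[p])))‖ = 1 ∧
      ‖ι.symm (((W.frobeniusTrace p : ℤ) : ℂ) -
          ι (algebraMap ℚ_[p] (PadicAlgCl p) (unitRoot W p : ℚ_[p])))‖ < 1 := by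
  obtain ⟨hu, hu1⟩ := algebraMap_unitRoot_spec W hord
  have hroot : (ι (algebraMap ℚ_[p] (PadicAlgCl p) (unitRoot W p : ℚ_[p]))) ^ 2 -
      ((W.frobeniusTrace p : ℤ) : ℂ) * ι (algebraMap ℚ_[p] (PadicAlgCl p) (unitRoot W p : ℚ_[p]))
        + p = 0 := by
    have h := congr_arg ι hu
    rwa [map_zero, map_add, map_sub, map_pow, map_mul, map_intCast, map_natCast] at h
  have h1 : ‖ι.symm (ι (algebraMap ℚ_[p] (PadicAlgCl p) (unitRoot W p : ℚ_[p])))‖ = 1 := by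
    rw [RingEquiv.symm_apply_apply, hu1]
  refine ⟨hroot, h1, ?_⟩
  rcases norm_symm_root_dichotomy ι hord.2 hroot with ⟨h, -⟩ | ⟨-, h⟩
  · exact absurd h1 h.ne
  · exact h

end UnitRoot

/-! ### The Hecke polynomial of the value frames is `X² − a_p(E) X + p` -/

section Newform

variable {N : ℕ} [NeZero N] {f : CuspForm (Gamma0 N) 2} (ι : PadicAlgCl p ≃+* ℂ)
  {W : WeierstrassCurve ℚ} [W.IsElliptic] [W.IsGloballyMinimal]

/-- For the newform `f` of `E` and a good prime `p`: `cuspCoeff f p = a_p(E)`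
(`IsNewformOf`: `a_n(f) = a_n(E)`; `LFunction_apply_prime_eq_frobeniusTrace`: the `p`-th
`L`-series coefficient at a good prime is the trace of Frobenius).
[cite: SilvermanAEC2009, §C.16 (PDF p. 390) with Exercise 8.19(a) (p. 230)] -/
theorem IsNewformOf.cuspCoeff_prime_eq_frobeniusTrace (hf : IsNewformOf W f)
    (hgood : W.HasGoodReductionAtPrime p) :
    cuspCoeff f p = ((W.frobeniusTrace p : ℤ) : ℂ) := by
  rw [hf.2 p, LFunction_apply_prime_eq_frobeniusTrace W p hgood]

variable {α : ℂ}

/-- **The root clause of the two-variable value frames at a good ORDINARY prime**: a complex root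
`α` of `X² − cuspCoeff f p · X + p` (the clause of `IsGreenbergLFunctionAnyRoot₂`) is either THE
unit root `ι(unitRoot W p)` (the `α_p` of `CastellaGrossiSkinner2025.hidaIIInterpolationValue`) or
`p/α` is. [cite: YanZhu2024MainConjNonCM, Thm. 3.9 (the unit root α, arXiv:2412.20078v4 l.846)]
[cite: CastellaGrossiSkinner2025, §4 (l.1659–1663)] -/
theorem eq_unitRoot_or_div_eq_unitRoot_of_isNewformOf (hf : IsNewformOf W f)
    (hord : IsOrdinaryAt W p) (hα : α ^ 2 - cuspCoeff f p * α + p = 0) :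
    α = ι (algebraMap ℚ_[p] (PadicAlgCl p) (unitRoot W p : ℚ_[p])) ∨
      (p : ℂ) / α = ι (algebraMap ℚ_[p] (PadicAlgCl p) (unitRoot W p : ℚ_[p])) := by
  rw [IsNewformOf.cuspCoeff_prime_eq_frobeniusTrace hf hord.1] at hα
  exact eq_unitRoot_or_div_eq_unitRoot ι hord hα

/-- Same clause, norm form: `‖ι⁻¹α‖ = 1` or `‖ι⁻¹(p/α)‖ = 1`, and both `≤ 1`.
[cite: YanZhu2024MainConjNonCM, Thm. 3.9 (the unit root α, arXiv:2412.20078v4 l.846)] -/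
theorem norm_symm_eq_one_or_of_isNewformOf (hf : IsNewformOf W f) (hord : IsOrdinaryAt W p)
    (hα : α ^ 2 - cuspCoeff f p * α + p = 0) :
    (‖ι.symm α‖ = 1 ∨ ‖ι.symm ((p : ℂ) / α)‖ = 1) ∧ ‖ι.symm α‖ ≤ 1 := by
  rw [IsNewformOf.cuspCoeff_prime_eq_frobeniusTrace hf hord.1] at hα
  exact ⟨norm_symm_eq_one_or_norm_symm_div_eq_one ι hord.2 hα, norm_symm_root_le_one ι hord.2 hα⟩

/-- **Under the unit-root clause the frames agree on `α`**: if `α` is a complex root of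
`X² − cuspCoeff f p · X + p` with `‖ι⁻¹α‖ = 1` (the clause of the superseded
`YanZhu2026.….IsGreenbergLFunction₂`), then `α = ι(unitRoot W p)` (the root used by
`CastellaGrossiSkinner2025.IsHidaRankinLFunctionII`).
[cite: CastellaGrossiSkinner2025, Thm. 2.4.1 (α_p, §4 l.1659–1663)] [cite: YanZhu2024MainConjNonCM, Thm. 3.9 (l.846)] -/
theorem eq_unitRoot_of_isNewformOf_of_norm_eq_one (hf : IsNewformOf W f) (hord : IsOrdinaryAt W p)
    (hα : α ^ 2 - cuspCoeff f p * α + p = 0) (h1 : ‖ι.symm α‖ = 1) :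
    α = ι (algebraMap ℚ_[p] (PadicAlgCl p) (unitRoot W p : ℚ_[p])) := by
  rw [IsNewformOf.cuspCoeff_prime_eq_frobeniusTrace hf hord.1] at hα
  exact eq_unitRoot_of_norm_eq_one ι hord hα h1

end Newform

end Literature.NumberTheory.EllipticCurves

end
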